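import Summits.BirchSwinnertonDyer.Rank1Residual.GaloisImage.KolyvaginScalarTransport
import HarnessLib

/-!
# Route `KimAtThreeKolyvagin` (rung W2), crux `StubAtEmptyLevelThree` (item 19561): PROPORTIONALITY of two
# generators at a CORE VERTEX (input (L-c) of the liftability road `KimAtThreeStubLiftability`)

Cell `bsd-addord`, seat `bsd-addord-w2-c2` (gen 3). TOOL FILE: one theorem, no definition, no named fact, no
`sorry`; closes nothing; books nothing. HONEST FRAMING: BSD is not proved by any of this; item 19561 stays
OPEN. This is steps S2–S3 of cell n1011's scalar transport (`Transport.pow_dvd_iff_of_comp`, seat p11,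
`KolyvaginScalarTransport.lean`) EXTRACTED as a standalone statement, with the same hypotheses and the same
proof: at two depths `k ≤ k′`, for Kolyvagin systems `g` (level `k`) and `g′` (level `k′`, of additive order
`3^{k′+1}`) on data `D ⊇ D′` with cyclotomic transverse conditions, GRANTED the ORDER form of [S24]
Thm. 4.4 (2) and the Poitou–Tate pair count at both depths, there is a level `d₀` of `D′` — a coordinate where
`g′` has full order, hence a CORE VERTEX at both depths (`#N_{d₀}(k′) = #N_{d₀}(k) = 1`) — at which
`red_*(g′_{d₀}) = w • g_{d₀}` with `3 ∤ w`. This is the hypothesis (L-c) of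
`KimAtThreeStubOfLiftable.exists_lift_apply_empty_of_coreVertex` / `stubShape_of_coreVertex_inputs`.

* `exists_coreVertex_map_red_eq_smul` — `∃ d₀, D′.IsLevel d₀ ∧ ∃ w : ℤ, IsCoprime w 3 ∧
  red_*(g′ d₀) = w • g d₀` (and `d₀` is a core vertex at both depths).

References: [MazurRubin2004] Thm. 4.4.1 (p. 45), Thm. 4.1.13; [Sakamoto2024] Thm. 4.4 (2) (p. 926); cell n1011
`Transport.pow_dvd_iff_of_comp` (skeleton T-R1-23 S2–S3).
-/

-- the Theorems namespace of a single-conjunct summit repeats the summit name by design (D-0017)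
set_option linter.dupNamespace false

noncomputable section

open scoped Classical NumberField ContRepresentation
open Function Field NumberField IsDedekindDomain WeierstrassCurve Literature.NumberTheory.EllipticCurves
  Literature.NumberTheory.GaloisRepresentations Literature.NumberTheory.GaloisRepresentations.DiscreteGaloisModule
  Literature.NumberTheory.GaloisCohomology
  Summit.BirchSwinnertonDyer.Rank1Residual.GaloisImage Summit.BirchSwinnertonDyer.Rank1Residual.GaloisImage.Transport

namespace Summit.BirchSwinnertonDyer.BirchSwinnertonDyer.Theorems.KimAtThreeStubOfLiftable

/-- **A core vertex where the two generators are proportional by a unit** (input (L-c)). Two depths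
`k ≤ k′`, data `D` on `E[3^{k+1}]` and `D′` on `E[3^{k′+1}]` with `D′.primes ⊆ D.primes` and cyclotomic
transverse conditions, THE reduction `red` (`x ↦ 3^{k′−k}x`), surj(3), Kolyvagin systems `g`, `g′` with
`g′` of additive order `3^{k′+1}`, the ORDER form of [S24] Thm. 4.4 (2) and the Poitou–Tate pair count at both
depths: then at some level `d₀` of `D′` (where `g′_{d₀}` has full order; `#N_{d₀} = 1` at both depths, the stalks
are cyclic of orders `3^{k′+1}`, `3^{k+1}` generated by `g′_{d₀}`, `g_{d₀}`) one has `red_*(g′_{d₀}) = w • g_{d₀}`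
with `w` prime to `3`. Proof = n1011's `Transport.pow_dvd_iff_of_comp`, steps S2–S3, verbatim.
[cite: MazurRubin2004, Thm. 4.4.1 (p. 45)] [cite: Sakamoto2024, Thm. 4.4 (2) (p. 926)] -/
theorem exists_coreVertex_map_red_eq_smul (W : WeierstrassCurve ℚ) [W.IsElliptic]
    {k k' : ℕ} (hk : k ≤ k')
    [Finite (geomTorsion W (((3 : ℕ) : ℤ) ^ k * ((3 : ℕ) : ℤ)))]
    [Finite (geomTorsion W (((3 : ℕ) : ℤ) ^ k' * ((3 : ℕ) : ℤ)))]
    (D : KolyvaginDatum (W.torsionGaloisModule (((3 : ℕ) : ℤ) ^ k * ((3 : ℕ) : ℤ))))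
    (D' : KolyvaginDatum (W.torsionGaloisModule (((3 : ℕ) : ℤ) ^ k' * ((3 : ℕ) : ℤ))))
    (red : (W.torsionGaloisModule (((3 : ℕ) : ℤ) ^ k' * ((3 : ℕ) : ℤ))).toContRepresentation →ⁱL
      (W.torsionGaloisModule (((3 : ℕ) : ℤ) ^ k * ((3 : ℕ) : ℤ))).toContRepresentation)
    (hred : ∀ x : geomTorsion W (((3 : ℕ) : ℤ) ^ k' * ((3 : ℕ) : ℤ)),
      ((red x : geomTorsion W (((3 : ℕ) : ℤ) ^ k * ((3 : ℕ) : ℤ))) : geomPoints W) =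
        (((3 : ℕ) : ℤ) ^ (k' - k)) • (x : geomPoints W))
    (hsurj : W.HasSurjectiveModNGaloisRep ((3 : ℕ) : ℤ))
    (hT : D.transverse = cyclotomicTransverse _) (hT' : D'.transverse = cyclotomicTransverse _)
    (hPP : D'.primes ⊆ D.primes)
    (inv : LocalInvariants ℚ (3 ^ (k + 1))) (inv' : LocalInvariants ℚ (3 ^ (k' + 1)))
    {g : Finset (HeightOneSpectrum (𝓞 ℚ)) →
      galoisCohomology (W.torsionGaloisModule (((3 : ℕ) : ℤ) ^ k * ((3 : ℕ) : ℤ))) 1}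
    (hg : g ∈ D.kolyvaginSystems (propagatedSelmerStructure W 3 k))
    {g' : Finset (HeightOneSpectrum (𝓞 ℚ)) →
      galoisCohomology (W.torsionGaloisModule (((3 : ℕ) : ℤ) ^ k' * ((3 : ℕ) : ℤ))) 1}
    (hg' : g' ∈ D'.kolyvaginSystems (propagatedSelmerStructure W 3 k'))
    (hgo' : addOrderOf g' = 3 ^ (k' + 1))
    -- [S24] Thm. 4.4 (2), ORDER form, both depths
    (hR22 : ∀ d, D.IsLevel d →
      (Nat.card (inv.dualSelmerStructure _ (D.atLevel (propagatedSelmerStructure W 3 k) d)).selmerGroup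
          ∣ 3 ^ (k + 1) →
        addOrderOf (g d) * Nat.card (inv.dualSelmerStructure _
          (D.atLevel (propagatedSelmerStructure W 3 k) d)).selmerGroup = 3 ^ (k + 1)) ∧
      (3 ^ (k + 1) ∣ Nat.card (inv.dualSelmerStructure _
          (D.atLevel (propagatedSelmerStructure W 3 k) d)).selmerGroup → g d = 0))
    (hR22' : ∀ d, D'.IsLevel d →
      (Nat.card (inv'.dualSelmerStructure _ (D'.atLevel (propagatedSelmerStructure W 3 k') d)).selmerGroup
          ∣ 3 ^ (k' + 1) →
        addOrderOf (g' d) * Nat.card (inv'.dualSelmerStructure _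
          (D'.atLevel (propagatedSelmerStructure W 3 k') d)).selmerGroup = 3 ^ (k' + 1)) ∧
      (3 ^ (k' + 1) ∣ Nat.card (inv'.dualSelmerStructure _
          (D'.atLevel (propagatedSelmerStructure W 3 k') d)).selmerGroup → g' d = 0))
    -- Poitou–Tate pair counts at both depths
    (hPT : ∀ d, D.IsLevel d →
      Nat.card (D.atLevel (propagatedSelmerStructure W 3 k) d).selmerGroup =
        3 ^ (k + 1) * Nat.card (inv.dualSelmerStructure _
          (D.atLevel (propagatedSelmerStructure W 3 k) d)).selmerGroup)
    (hPT' : ∀ d, D'.IsLevel d →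
      Nat.card (D'.atLevel (propagatedSelmerStructure W 3 k') d).selmerGroup =
        3 ^ (k' + 1) * Nat.card (inv'.dualSelmerStructure _
          (D'.atLevel (propagatedSelmerStructure W 3 k') d)).selmerGroup) :
    ∃ d₀ : Finset (HeightOneSpectrum (𝓞 ℚ)), D'.IsLevel d₀ ∧
      Nat.card (inv'.dualSelmerStructure _ (D'.atLevel (propagatedSelmerStructure W 3 k') d₀)).selmerGroup = 1 ∧
      Nat.card (inv.dualSelmerStructure _ (D.atLevel (propagatedSelmerStructure W 3 k) d₀)).selmerGroup = 1 ∧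
      ∃ w : ℤ, IsCoprime w 3 ∧ galoisCohomology.map red 1 (g' d₀) = w • g d₀ := by
  haveI : Fact (Nat.Prime 3) := ⟨Nat.prime_three⟩
  have hK : D.IsKolyvaginSystem (propagatedSelmerStructure W 3 k) g :=
    (KolyvaginDatum.mem_kolyvaginSystems_iff _ _ _).mp hg
  have hK' : D'.IsKolyvaginSystem (propagatedSelmerStructure W 3 k') g' :=
    (KolyvaginDatum.mem_kolyvaginSystems_iff _ _ _).mp hg'
  -- S2: a coordinate `d₀` where `g'` has full order `3^{k'+1}`; it is a level of `D'` and of `D`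
  obtain ⟨d₀, hd₀o⟩ :=
    Ledger.exists_addOrderOf_apply_eq_pow (p := 3) g' (Nat.succ_pos k') hgo'
  have h1lt : 1 < 3 ^ (k' + 1) := Nat.one_lt_pow (Nat.succ_ne_zero k') (by norm_num)
  have hd₀' : D'.IsLevel d₀ := by
    by_contra h
    have h0 := hK'.eq_zero_of_not_isLevel d₀ h
    rw [h0, addOrderOf_zero] at hd₀o
    omega
  have hd₀ : D.IsLevel d₀ := Set.Subset.trans hd₀' hPP
  -- the dual count at `(k', d₀)` is `1`
  have hN' : Nat.card (inv'.dualSelmerStructure _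
      (D'.atLevel (propagatedSelmerStructure W 3 k') d₀)).selmerGroup = 1 :=
    natCard_eq_one_of_order_clauses (p := 3) (g' d₀) (Nat.succ_pos k') hd₀o
      (fun n => Subtype.ext (by
        rw [AddSubmonoidClass.coe_nsmul, ZeroMemClass.coe_zero]
        exact galoisCohomology.nsmul_eq_zero_of_forall _
          (fun f => DiscreteGaloisModule.TateDual.nsmul_eq_zero f) n.1))
      (hR22' d₀ hd₀').1 (hR22' d₀ hd₀').2
  -- `H' := H¹_{𝓕'(d₀)}(ℚ, E[3^{k'+1}])` has order `3^{k'+1}` and is cyclic, generated by `g' d₀`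
  have hcH' : Nat.card (D'.atLevel (propagatedSelmerStructure W 3 k') d₀).selmerGroup =
      3 ^ (k' + 1) := by rw [hPT' d₀ hd₀', hN', mul_one]
  haveI hfinH' : Finite (D'.atLevel (propagatedSelmerStructure W 3 k') d₀).selmerGroup :=
    Nat.finite_of_card_ne_zero (by rw [hcH']; positivity)
  have hg'mem : g' d₀ ∈ (D'.atLevel (propagatedSelmerStructure W 3 k') d₀).selmerGroup :=
    hK'.mem_selmerGroup d₀ hd₀'
  haveI : IsAddCyclic (D'.atLevel (propagatedSelmerStructure W 3 k') d₀).selmerGroup := by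
    refine isAddCyclic_of_addOrderOf_eq_card ⟨g' d₀, hg'mem⟩ ?_
    rw [hcH', ← hd₀o, AddSubgroup.addOrderOf_mk]
  -- S3, level `k`: `incl_*` embeds `H := H¹_{𝓕(d₀)}(ℚ, E[3^{k+1}])` into `H'`, so `#N_{d₀}(k) = 1`
  set incl := W.torsionInclusion (pow_mul_dvd_pow_mul hk) with hincl
  have hinj : Function.Injective (galoisCohomology.map incl 1) :=
    map_torsionInclusion_injective W hk (geomTorsion_eq_zero_of_fixed_of_surj W hsurj k')
  let f : (D.atLevel (propagatedSelmerStructure W 3 k) d₀).selmerGroup →+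
      (D'.atLevel (propagatedSelmerStructure W 3 k') d₀).selmerGroup :=
    ((galoisCohomology.map incl 1).comp (AddSubgroup.subtype _)).codRestrict _
      (fun x => map_torsionInclusion_mem_selmerGroup_atLevel W hk D D' hT hT' x.2)
  have hf : Function.Injective f := fun x y hxy => by
    apply Subtype.ext
    exact hinj (congrArg Subtype.val hxy)
  have hN : Nat.card (inv.dualSelmerStructure _
      (D.atLevel (propagatedSelmerStructure W 3 k) d₀)).selmerGroup = 1 :=
    eq_one_of_injective_of_isAddCyclic (p := 3) f hf
      (fun h => Subtype.ext (by
        rw [AddSubmonoidClass.coe_nsmul, ZeroMemClass.coe_zero]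
        exact pow_succ_nsmul_galoisCohomology W k h.1))
      (hPT d₀ hd₀) (by norm_num)
  -- `g d₀` has full order `3^{k+1} = #H`
  have hgo₀ : addOrderOf (g d₀) = 3 ^ (k + 1) := by
    have h := (hR22 d₀ hd₀).1 (by rw [hN]; exact one_dvd _)
    rwa [hN, mul_one] at h
  have hcH : Nat.card (D.atLevel (propagatedSelmerStructure W 3 k) d₀).selmerGroup = 3 ^ (k + 1) := by
    rw [hPT d₀ hd₀, hN, mul_one]
  haveI : Finite (D.atLevel (propagatedSelmerStructure W 3 k) d₀).selmerGroup :=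
    Nat.finite_of_card_ne_zero (by rw [hcH]; positivity)
  -- `red_* (g' d₀) ∈ H` is a natural multiple `w • g d₀`, and `3 ∤ w`
  have hymem : galoisCohomology.map red 1 (g' d₀) ∈
      (D.atLevel (propagatedSelmerStructure W 3 k) d₀).selmerGroup :=
    map_red_mem_selmerGroup_atLevel W hk red hred D D' hT hT' hg'mem
  obtain ⟨w, hw⟩ := exists_nsmul_eq_of_addOrderOf_eq_natCard _ (hK.mem_selmerGroup d₀ hd₀) hymem
    (hgo₀.trans hcH.symm)
  have hw3 : ¬ 3 ∣ w := by
    refine Ledger.not_dvd_of_comp_eq_pow_nsmul (p := 3) (galoisCohomology.map incl 1) hinj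
      (galoisCohomology.map red 1) (K₀ := k + 1) (r := k' - k) (Nat.succ_pos k) (g' d₀)
      (by rw [show k + 1 + (k' - k) = k' + 1 by omega]; exact hd₀o)
      (map_torsionInclusion_map_red W hk red hred (g' d₀)) (g d₀) hgo₀ w hw.symm
  refine ⟨d₀, hd₀', hN', hN, (w : ℤ), ?_, ?_⟩
  · exact Nat.isCoprime_iff_coprime.mpr ((Nat.Prime.coprime_iff_not_dvd Nat.prime_three).mpr hw3).symm
  · rw [natCast_zsmul, hw]

end Summit.BirchSwinnertonDyer.BirchSwinnertonDyer.Theorems.KimAtThreeStubOfLiftable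

end
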